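import Summits.CriticalPhenomena.SAWScalingLimit.Theorems.SAWLoopFugacityFlowIsingBoundaryRatioRadialDefs
import HarnessLib

/-!
# The grid path of lattice squares along the radial chain
(line `fk-anchor-transfer`, crux `IsingBoundaryRatio`, stmt-CriticalPhenomena-10650; helper file of the stub
`stub_halfAnnulusRadialCrossingBound`, RSW clause (iii))

Pure lattice geometry for the bulk RSW chain: given finitely many centres `c 0, …, c K ∈ ℂ`, a mesh `δ > 0` and
a side `s` (in lattice units), the lattice squares of side `s` at the scaled cells of the Manhattan (taxicab)
paths joining the anchor cells `⌊c_j / (s δ)⌋` of consecutive centres form a chain `gridCorner c δ s P i`,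
`i ≤ K P` (`P` indices per segment, the path resting once it has arrived), in which consecutive squares are
equal or side-adjacent (`gridCorner_step`), the first and last squares sit at the first and last centre
(`gridCorner_first/last_near`), and every square of the `j`-th segment is within
`‖c_{j+1} - c_j‖ + 2 s δ` of `c_j` in each coordinate (`gridCorner_near`). [folklore]
-/

noncomputable section

open scoped Classical
open Set
open Literature.Probability.LatticeModels

namespace Summit.CriticalPhenomena.SAWScalingLimit.Theorems.IsingBoundaryRatio

namespace RadialChain

/-! ### One coordinate: stepping towards a target -/

/-- Step `t` of the unit-speed motion on `ℤ` from `p` towards `q` (resting at `q`). [folklore] -/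
def stepTowards (p q : ℤ) (t : ℕ) : ℤ := if p ≤ q then min (p + t) q else max (p - t) q

/-- The motion starts at `p`. [folklore] -/
theorem stepTowards_zero (p q : ℤ) : stepTowards p q 0 = p := by
  unfold stepTowards; split_ifs <;> omega

/-- After `|q - p|` steps the motion rests at `q`. [folklore] -/
theorem stepTowards_of_le {p q : ℤ} {t : ℕ} (h : (q - p).natAbs ≤ t) : stepTowards p q t = q := by
  unfold stepTowards; split_ifs <;> omega

/-- One step moves by at most one. [folklore] -/
theorem stepTowards_succ (p q : ℤ) (t : ℕ) :
    stepTowards p q (t + 1) = stepTowards p q t ∨ stepTowards p q (t + 1) = stepTowards p q t + 1 ∨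
      stepTowards p q (t + 1) = stepTowards p q t - 1 := by
  unfold stepTowards; split_ifs <;> omega

/-- Before arrival the motion has not stopped; after arrival it rests. [folklore] -/
theorem stepTowards_succ_eq_iff (p q : ℤ) (t : ℕ) :
    (stepTowards p q (t + 1) = stepTowards p q t ↔ (q - p).natAbs ≤ t) := by
  unfold stepTowards; split_ifs <;> omega

/-- The motion stays between `p` and `q`. [folklore] -/
theorem abs_stepTowards_sub_le (p q : ℤ) (t : ℕ) : |stepTowards p q t - p| ≤ |q - p| := by
  unfold stepTowards
  split_ifs with h
  · rw [abs_of_nonneg (by omega), abs_of_nonneg (by omega)]; omega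
  · rw [abs_of_nonpos (by omega), abs_of_nonpos (by omega)]; omega

/-! ### The Manhattan path between two cells -/

/-- Step `t` of the Manhattan path from the cell `a` to the cell `b`: first horizontally, then vertically,
then resting at `b`. [folklore] -/
def manhattan (a b : Site 2) (t : ℕ) : Site 2 :=
  ![stepTowards (a 0) (b 0) t, stepTowards (a 1) (b 1) (t - (b 0 - a 0).natAbs)]

/-- First coordinate of the Manhattan path. [folklore] -/
theorem manhattan_apply_zero (a b : Site 2) (t : ℕ) : manhattan a b t 0 = stepTowards (a 0) (b 0) t := rfl

/-- Second coordinate of the Manhattan path. [folklore] -/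
theorem manhattan_apply_one (a b : Site 2) (t : ℕ) :
    manhattan a b t 1 = stepTowards (a 1) (b 1) (t - (b 0 - a 0).natAbs) := rfl

/-- The Manhattan path starts at `a`. [folklore] -/
theorem manhattan_zero (a b : Site 2) : manhattan a b 0 = a := by
  ext i; fin_cases i
  · exact stepTowards_zero _ _
  · show stepTowards (a 1) (b 1) (0 - (b 0 - a 0).natAbs) = a 1
    rw [Nat.zero_sub]; exact stepTowards_zero _ _

/-- After `|b₀ - a₀| + |b₁ - a₁|` steps the path rests at `b`. [folklore] -/
theorem manhattan_of_le {a b : Site 2} {t : ℕ} (h : (b 0 - a 0).natAbs + (b 1 - a 1).natAbs ≤ t) :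
    manhattan a b t = b := by
  ext i; fin_cases i
  · exact stepTowards_of_le (by omega)
  · show stepTowards (a 1) (b 1) (t - (b 0 - a 0).natAbs) = b 1
    exact stepTowards_of_le (by omega)

/-- Vector equations on `Site 2` in coordinates. [folklore] -/
theorem eq_add_vec_iff (x y : Site 2) (c₀ c₁ : ℤ) : x = y + ![c₀, c₁] ↔ x 0 = y 0 + c₀ ∧ x 1 = y 1 + c₁ := by
  constructor
  · intro h; rw [h]; simp
  · rintro ⟨h0, h1⟩; ext i; fin_cases i
    · simpa using h0
    · simpa using h1

/-- **Consecutive cells of the Manhattan path are equal or adjacent.** [folklore] -/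
theorem manhattan_succ (a b : Site 2) (t : ℕ) :
    manhattan a b (t + 1) = manhattan a b t ∨
    manhattan a b (t + 1) = manhattan a b t + ![1, 0] ∨ manhattan a b t = manhattan a b (t + 1) + ![1, 0] ∨
    manhattan a b (t + 1) = manhattan a b t + ![0, 1] ∨ manhattan a b t = manhattan a b (t + 1) + ![0, 1] := by
  set n := (b 0 - a 0).natAbs with hn
  have h0 := stepTowards_succ (a 0) (b 0) t
  have h0' := stepTowards_succ_eq_iff (a 0) (b 0) t
  -- coordinate form
  have H : (manhattan a b (t + 1) 0 = manhattan a b t 0 ∧ manhattan a b (t + 1) 1 = manhattan a b t 1) ∨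
      (manhattan a b (t + 1) 0 = manhattan a b t 0 + 1 ∧ manhattan a b (t + 1) 1 = manhattan a b t 1) ∨
      (manhattan a b t 0 = manhattan a b (t + 1) 0 + 1 ∧ manhattan a b t 1 = manhattan a b (t + 1) 1) ∨
      (manhattan a b (t + 1) 0 = manhattan a b t 0 ∧ manhattan a b (t + 1) 1 = manhattan a b t 1 + 1) ∨
      (manhattan a b t 0 = manhattan a b (t + 1) 0 ∧ manhattan a b t 1 = manhattan a b (t + 1) 1 + 1) := by
    simp only [manhattan_apply_zero, manhattan_apply_one, ← hn]
    by_cases ht : n ≤ t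
    · -- horizontal motion finished: vertical step
      have hx : stepTowards (a 0) (b 0) (t + 1) = stepTowards (a 0) (b 0) t := h0'.2 ht
      have ht1 : t + 1 - n = (t - n) + 1 := by omega
      rw [ht1]
      have h1 := stepTowards_succ (a 1) (b 1) (t - n)
      omega
    · -- horizontal step, vertical coordinate at rest
      have ht0 : t - n = 0 := by omega
      have ht1 : t + 1 - n = 0 := by omega
      rw [ht0, ht1]
      have hx : stepTowards (a 0) (b 0) (t + 1) ≠ stepTowards (a 0) (b 0) t := fun h => ht (h0'.1 h)
      omega
  rcases H with h | h | h | h | h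
  · left; ext k; fin_cases k; exacts [h.1, h.2]
  · exact Or.inr (Or.inl ((eq_add_vec_iff _ _ _ _).2 ⟨h.1, by rw [h.2, add_zero]⟩))
  · exact Or.inr (Or.inr (Or.inl ((eq_add_vec_iff _ _ _ _).2 ⟨h.1, by rw [h.2, add_zero]⟩)))
  · exact Or.inr (Or.inr (Or.inr (Or.inl ((eq_add_vec_iff _ _ _ _).2 ⟨by rw [h.1, add_zero], h.2⟩))))
  · exact Or.inr (Or.inr (Or.inr (Or.inr ((eq_add_vec_iff _ _ _ _).2 ⟨by rw [h.1, add_zero], h.2⟩))))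

/-- The cells of the Manhattan path stay in the bounding box of its ends. [folklore] -/
theorem abs_manhattan_sub_le (a b : Site 2) (t : ℕ) :
    |manhattan a b t 0 - a 0| ≤ |b 0 - a 0| ∧ |manhattan a b t 1 - a 1| ≤ |b 1 - a 1| :=
  ⟨abs_stepTowards_sub_le _ _ _, abs_stepTowards_sub_le _ _ _⟩

/-! ### Anchor cells and the grid path -/

/-- The anchor cell `⌊c / (s δ)⌋` of the point `c` for squares of side `s` at mesh `δ`. [folklore] -/
def anchorCell (δ : ℝ) (s : ℕ) (c : ℂ) : Site 2 := ![⌊c.re / (s * δ)⌋, ⌊c.im / (s * δ)⌋]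

/-- First coordinate of the anchor cell. [folklore] -/
theorem anchorCell_apply_zero (δ : ℝ) (s : ℕ) (c : ℂ) : anchorCell δ s c 0 = ⌊c.re / (s * δ)⌋ := rfl

/-- Second coordinate of the anchor cell. [folklore] -/
theorem anchorCell_apply_one (δ : ℝ) (s : ℕ) (c : ℂ) : anchorCell δ s c 1 = ⌊c.im / (s * δ)⌋ := rfl

/-- The cell of index `i` of the grid path through the centres `c 0, …, c K`, with `P` indices per segment:
on the `j`-th segment (`i = j P + t`, `t < P`, `j < K`) the `t`-th cell of the Manhattan path from the anchor of
`c j` to the anchor of `c (j+1)`; from index `K P` on, the anchor of `c K`. [folklore] -/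
def gridCell (c : ℕ → ℂ) (K : ℕ) (δ : ℝ) (s P : ℕ) (i : ℕ) : Site 2 :=
  if i < K * P then manhattan (anchorCell δ s (c (i / P))) (anchorCell δ s (c (i / P + 1))) (i % P)
  else anchorCell δ s (c K)

/-- The lower-left corner (in lattice units) of the square of index `i` of the grid path: `s` times the cell.
[folklore] -/
def gridCorner (c : ℕ → ℂ) (K : ℕ) (δ : ℝ) (s P : ℕ) (i : ℕ) : Site 2 := (s : ℤ) • gridCell c K δ s P i

/-- Coordinates of the corners of the grid path. [folklore] -/
theorem gridCorner_apply (c : ℕ → ℂ) (K : ℕ) (δ : ℝ) (s P : ℕ) (i : ℕ) (k : Fin 2) :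
    gridCorner c K δ s P i k = s * gridCell c K δ s P i k := by
  simp [gridCorner]

/-- Difference of floors: `|⌊x⌋ - ⌊y⌋| < |x - y| + 1`. [folklore] -/
theorem abs_floor_sub_floor_lt (x y : ℝ) : (|⌊x⌋ - ⌊y⌋| : ℝ) < |x - y| + 1 := by
  have h1 := Int.floor_le x
  have h2 := Int.lt_floor_add_one x
  have h3 := Int.floor_le y
  have h4 := Int.lt_floor_add_one y
  rw [← Int.cast_sub, ← Int.cast_abs]
  have key : ((|⌊x⌋ - ⌊y⌋| : ℤ) : ℝ) < |x - y| + 1 := by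
    rcases le_or_gt ⌊y⌋ ⌊x⌋ with h | h
    · rw [abs_of_nonneg (sub_nonneg.2 h), Int.cast_sub]
      have := le_abs_self (x - y)
      linarith
    · rw [abs_of_neg (sub_neg.2 h), Int.cast_neg, Int.cast_sub]
      have := neg_abs_le (x - y)
      linarith
  exact key

/-- **Anchors of consecutive centres are close**: in each coordinate the anchors of `c`, `c'` differ by less
than `‖c' - c‖ / (s δ) + 1`. [folklore] -/
theorem abs_anchorCell_sub_lt {δ : ℝ} {s : ℕ} (hsδ : 0 < (s : ℝ) * δ) (c c' : ℂ) (k : Fin 2) :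
    (|anchorCell δ s c' k - anchorCell δ s c k| : ℝ) < ‖c' - c‖ / (s * δ) + 1 := by
  fin_cases k
  · show (|anchorCell δ s c' 0 - anchorCell δ s c 0| : ℝ) < ‖c' - c‖ / (s * δ) + 1
    rw [anchorCell_apply_zero, anchorCell_apply_zero]
    refine (abs_floor_sub_floor_lt _ _).trans_le ?_
    rw [← sub_div, abs_div, abs_of_pos hsδ, ← Complex.sub_re]
    gcongr
    exact Complex.abs_re_le_norm _
  · show (|anchorCell δ s c' 1 - anchorCell δ s c 1| : ℝ) < ‖c' - c‖ / (s * δ) + 1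
    rw [anchorCell_apply_one, anchorCell_apply_one]
    refine (abs_floor_sub_floor_lt _ _).trans_le ?_
    rw [← sub_div, abs_div, abs_of_pos hsδ, ← Complex.sub_im]
    gcongr
    exact Complex.abs_im_le_norm _

/-- The taxicab distance of the anchors of consecutive centres is at most `P - 1` when
`2 (‖c' - c‖ / (s δ) + 1) ≤ P - 1`. [folklore] -/
theorem natAbs_anchor_le {δ : ℝ} {s P : ℕ} (hsδ : 0 < (s : ℝ) * δ) {c c' : ℂ}
    (hP : 2 * (‖c' - c‖ / (s * δ) + 1) ≤ (P : ℝ) - 1) :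
    (anchorCell δ s c' 0 - anchorCell δ s c 0).natAbs + (anchorCell δ s c' 1 - anchorCell δ s c 1).natAbs ≤ P - 1 := by
  have h0 := abs_anchorCell_sub_lt hsδ c c' 0
  have h1 := abs_anchorCell_sub_lt hsδ c c' 1
  rw [← Int.cast_sub, ← Int.cast_abs, ← Int.natCast_natAbs, Int.cast_natCast] at h0 h1
  set n0 := (anchorCell δ s c' 0 - anchorCell δ s c 0).natAbs
  set n1 := (anchorCell δ s c' 1 - anchorCell δ s c 1).natAbs
  have hsum : ((n0 + n1 : ℕ) : ℝ) < (P : ℝ) - 1 := by push_cast; linarith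
  have hsum' : ((n0 + n1 : ℕ) : ℝ) + 1 < (P : ℝ) := by linarith
  have : n0 + n1 + 1 < P := by exact_mod_cast hsum'
  omega

/-! ### Properties of the grid path -/

section Grid

variable {c : ℕ → ℂ} {K : ℕ} {δ : ℝ} {s P : ℕ}

/-- **Consecutive squares of the grid path are equal or side-adjacent.** [folklore] -/
theorem gridCorner_step (hsδ : 0 < (s : ℝ) * δ) (hP : ∀ j < K, 2 * (‖c (j + 1) - c j‖ / (s * δ) + 1) ≤ (P : ℝ) - 1)
    (i : ℕ) (hi : i < K * P) :
    gridCorner c K δ s P (i + 1) = gridCorner c K δ s P i ∨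
    gridCorner c K δ s P (i + 1) = gridCorner c K δ s P i + ![(s : ℤ), 0] ∨
    gridCorner c K δ s P i = gridCorner c K δ s P (i + 1) + ![(s : ℤ), 0] ∨
    gridCorner c K δ s P (i + 1) = gridCorner c K δ s P i + ![(0 : ℤ), s] ∨
    gridCorner c K δ s P i = gridCorner c K δ s P (i + 1) + ![(0 : ℤ), s] := by
  have hP0 : 0 < P := Nat.pos_of_ne_zero fun h => by rw [h, mul_zero] at hi; exact Nat.not_lt_zero _ hi
  set j := i / P with hj
  set t := i % P with ht
  have hiP : i = j * P + t := by rw [hj, ht, mul_comm]; exact (Nat.div_add_mod i P).symm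
  have hjK : j < K := by
    rw [hj]; exact Nat.div_lt_of_lt_mul (by rw [mul_comm]; exact hi)
  have htP : t < P := Nat.mod_lt _ hP0
  -- scaling the five alternatives
  have hsmul : ∀ (x y : Site 2) (e : Site 2), x = y + e → (s : ℤ) • x = (s : ℤ) • y + (s : ℤ) • e := by
    intro x y e h; rw [h, smul_add]
  have he0 : (s : ℤ) • (![1, 0] : Site 2) = ![(s : ℤ), 0] := by ext k; fin_cases k <;> simp
  have he1 : (s : ℤ) • (![0, 1] : Site 2) = ![(0 : ℤ), s] := by ext k; fin_cases k <;> simp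
  have cell_i : gridCell c K δ s P i = manhattan (anchorCell δ s (c j)) (anchorCell δ s (c (j + 1))) t := by
    unfold gridCell; rw [if_pos hi]
  by_cases ht1 : t + 1 < P
  · -- same segment
    have hi1 : i + 1 < K * P := by
      calc i + 1 = j * P + (t + 1) := by rw [hiP]; ring
        _ < j * P + P := by omega
        _ = (j + 1) * P := by ring
        _ ≤ K * P := Nat.mul_le_mul_right _ hjK
    have hdiv : (i + 1) / P = j := by
      rw [hiP, add_assoc, mul_comm, Nat.mul_add_div hP0, Nat.div_eq_of_lt ht1]; simp
    have hmod : (i + 1) % P = t + 1 := by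
      rw [hiP, add_assoc, mul_comm, Nat.mul_add_mod, Nat.mod_eq_of_lt ht1]
    have cell_i1 : gridCell c K δ s P (i + 1) =
        manhattan (anchorCell δ s (c j)) (anchorCell δ s (c (j + 1))) (t + 1) := by
      unfold gridCell; rw [if_pos hi1, hdiv, hmod]
    unfold gridCorner
    rw [cell_i, cell_i1]
    rcases manhattan_succ (anchorCell δ s (c j)) (anchorCell δ s (c (j + 1))) t with h | h | h | h | h
    · exact Or.inl (by rw [h])
    · exact Or.inr (Or.inl (by rw [hsmul _ _ _ h, he0]))
    · exact Or.inr (Or.inr (Or.inl (by rw [hsmul _ _ _ h, he0])))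
    · exact Or.inr (Or.inr (Or.inr (Or.inl (by rw [hsmul _ _ _ h, he1]))))
    · exact Or.inr (Or.inr (Or.inr (Or.inr (by rw [hsmul _ _ _ h, he1]))))
  · -- end of the segment: both cells are the anchor of `c (j + 1)`
    left
    have htP1 : t = P - 1 := by omega
    have harr : manhattan (anchorCell δ s (c j)) (anchorCell δ s (c (j + 1))) t = anchorCell δ s (c (j + 1)) :=
      manhattan_of_le (htP1 ▸ natAbs_anchor_le hsδ (hP j hjK))
    have hi1 : i + 1 = (j + 1) * P := by rw [hiP, htP1]; rw [add_mul, one_mul]; omega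
    have cell_i1 : gridCell c K δ s P (i + 1) = anchorCell δ s (c (j + 1)) := by
      unfold gridCell
      by_cases hjK1 : j + 1 < K
      · have hlt : i + 1 < K * P := by
          rw [hi1]; exact Nat.mul_lt_mul_of_lt_of_le hjK1 le_rfl hP0
        rw [if_pos hlt, hi1, Nat.mul_div_cancel _ hP0, Nat.mul_mod_left, manhattan_zero]
      · have hjK1' : j + 1 = K := by omega
        have hnlt : ¬ (i + 1 < K * P) := by rw [hi1, hjK1']; exact lt_irrefl _
        rw [if_neg hnlt, ← hjK1']
    unfold gridCorner
    rw [cell_i, cell_i1, harr]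

/-- **Localisation of the squares**: every site `z` of the square of index `i ≤ K P` is, in each coordinate,
within `‖c (j+1) - c j‖ + 2 s δ` of the centre `c j` of its segment (`j = i / P < K`), or within `2 s δ` of
`c K` (`i = K P`). [folklore] -/
theorem gridCorner_near (hδ : 0 < δ) (hsδ : 0 < (s : ℝ) * δ) (i : ℕ) (hi : i ≤ K * P) :
    ∃ j ≤ K, ∀ z : Site 2, gridCorner c K δ s P i 0 ≤ z 0 → z 0 ≤ gridCorner c K δ s P i 0 + s →
      gridCorner c K δ s P i 1 ≤ z 1 → z 1 ≤ gridCorner c K δ s P i 1 + s →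
      |δ * z 0 - (c j).re| ≤ (if j < K then ‖c (j + 1) - c j‖ else 0) + 2 * s * δ ∧
      |δ * z 1 - (c j).im| ≤ (if j < K then ‖c (j + 1) - c j‖ else 0) + 2 * s * δ := by
  -- the cell `m` of index `i` is near the anchor of `c j`: `s δ |m - anchor| ≤ B` coordinatewise
  have main : ∀ (j : ℕ) (m : Site 2) (B : ℝ), (∀ k : Fin 2, (s * δ) * |(m k : ℝ) - anchorCell δ s (c j) k| ≤ B) →
      ∀ z : Site 2, s * m 0 ≤ z 0 → z 0 ≤ s * m 0 + s → s * m 1 ≤ z 1 → z 1 ≤ s * m 1 + s →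
      |δ * z 0 - (c j).re| ≤ B + s * δ ∧ |δ * z 1 - (c j).im| ≤ B + s * δ := by
    intro j m B hB z h1 h2 h3 h4
    have key : ∀ (x : ℝ) (mk ak zk : ℤ), (s * δ) * |(mk : ℝ) - ak| ≤ B → (ak : ℝ) ≤ x / (s * δ) →
        x / (s * δ) < ak + 1 → s * mk ≤ zk → zk ≤ s * mk + s → |δ * zk - x| ≤ B + s * δ := by
      intro x mk ak zk hBk ha1 ha2 hz1 hz2
      rw [le_div_iff₀ hsδ] at ha1
      rw [div_lt_iff₀ hsδ] at ha2
      have hz1' : (s : ℝ) * mk ≤ zk := by exact_mod_cast hz1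
      have hz2' : (zk : ℝ) ≤ s * mk + s := by exact_mod_cast hz2
      have e1 : δ * (s * mk) ≤ δ * zk := mul_le_mul_of_nonneg_left hz1' hδ.le
      have e2 : δ * zk ≤ δ * (s * mk + s) := mul_le_mul_of_nonneg_left hz2' hδ.le
      have e3 : (s * δ) * ((mk : ℝ) - ak) ≤ B := (mul_le_mul_of_nonneg_left (le_abs_self _) hsδ.le).trans hBk
      have e4 : (s * δ) * ((ak : ℝ) - mk) ≤ B := by
        have hle : (ak : ℝ) - mk ≤ |(mk : ℝ) - ak| := by rw [abs_sub_comm]; exact le_abs_self _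
        exact (mul_le_mul_of_nonneg_left hle hsδ.le).trans hBk
      rw [abs_le]; constructor <;> nlinarith
    refine ⟨key (c j).re (m 0) (anchorCell δ s (c j) 0) (z 0) (hB 0) ?_ ?_ h1 h2,
      key (c j).im (m 1) (anchorCell δ s (c j) 1) (z 1) (hB 1) ?_ ?_ h3 h4⟩
    · rw [anchorCell_apply_zero]; exact Int.floor_le _
    · rw [anchorCell_apply_zero]; exact Int.lt_floor_add_one _
    · rw [anchorCell_apply_one]; exact Int.floor_le _
    · rw [anchorCell_apply_one]; exact Int.lt_floor_add_one _
  by_cases hiK : i < K * P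
  · have hP0 : 0 < P := Nat.pos_of_ne_zero fun h => by rw [h, mul_zero] at hiK; exact Nat.not_lt_zero _ hiK
    set j := i / P with hj
    have hjK : j < K := by rw [hj]; exact Nat.div_lt_of_lt_mul (by rw [mul_comm]; exact hiK)
    refine ⟨j, hjK.le, fun z h1 h2 h3 h4 => ?_⟩
    rw [if_pos hjK]
    set m := manhattan (anchorCell δ s (c j)) (anchorCell δ s (c (j + 1))) (i % P) with hm
    have hcell : gridCell c K δ s P i = m := by unfold gridCell; rw [if_pos hiK]
    simp only [gridCorner_apply, hcell] at h1 h2 h3 h4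
    have hB : ∀ k : Fin 2, (s * δ) * |(m k : ℝ) - anchorCell δ s (c j) k| ≤ ‖c (j + 1) - c j‖ + s * δ := by
      intro k
      have hnear := abs_manhattan_sub_le (anchorCell δ s (c j)) (anchorCell δ s (c (j + 1))) (i % P)
      have hk : |(m k : ℝ) - anchorCell δ s (c j) k| ≤ |(anchorCell δ s (c (j + 1)) k : ℝ) - anchorCell δ s (c j) k| := by
        rw [← Int.cast_sub, ← Int.cast_sub, ← Int.cast_abs, ← Int.cast_abs]
        fin_cases k
        · exact_mod_cast hnear.1
        · exact_mod_cast hnear.2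
      have hlt := abs_anchorCell_sub_lt hsδ (c j) (c (j + 1)) k
      have : (s * δ) * |(anchorCell δ s (c (j + 1)) k : ℝ) - anchorCell δ s (c j) k| ≤ ‖c (j + 1) - c j‖ + s * δ := by
        have := mul_le_mul_of_nonneg_left hlt.le hsδ.le
        rw [mul_add, mul_one, mul_div_cancel₀ _ hsδ.ne'] at this
        exact this
      exact (mul_le_mul_of_nonneg_left hk hsδ.le).trans this
    have := main j m _ hB z h1 h2 h3 h4
    refine ⟨this.1.trans (le_of_eq (by ring)), this.2.trans (le_of_eq (by ring))⟩
  · have hiK' : i = K * P := le_antisymm hi (not_lt.1 hiK)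
    refine ⟨K, le_rfl, fun z h1 h2 h3 h4 => ?_⟩
    rw [if_neg (lt_irrefl K)]
    have hcell : gridCell c K δ s P i = anchorCell δ s (c K) := by unfold gridCell; rw [if_neg hiK]
    simp only [gridCorner_apply, hcell] at h1 h2 h3 h4
    have hB : ∀ k : Fin 2, (s * δ) * |(anchorCell δ s (c K) k : ℝ) - anchorCell δ s (c K) k| ≤ s * δ := by
      intro k; rw [sub_self, abs_zero, mul_zero]; exact hsδ.le
    have := main K _ _ hB z h1 h2 h3 h4
    refine ⟨this.1.trans (le_of_eq (by ring)), this.2.trans (le_of_eq (by ring))⟩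

/-- A site of the square at an anchor cell is within `2 s δ` of the anchored coordinate. [folklore] -/
theorem abs_sub_le_of_anchor (hδ : 0 < δ) (hsδ : 0 < (s : ℝ) * δ) (x : ℝ) (zk : ℤ)
    (hz1 : s * ⌊x / (s * δ)⌋ ≤ zk) (hz2 : zk ≤ s * ⌊x / (s * δ)⌋ + s) : |δ * zk - x| ≤ 2 * s * δ := by
  have ha1 := Int.floor_le (x / (s * δ))
  have ha2 := Int.lt_floor_add_one (x / (s * δ))
  rw [le_div_iff₀ hsδ] at ha1
  rw [div_lt_iff₀ hsδ] at ha2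
  have hz1' : (s : ℝ) * ⌊x / (s * δ)⌋ ≤ zk := by exact_mod_cast hz1
  have hz2' : (zk : ℝ) ≤ s * ⌊x / (s * δ)⌋ + s := by exact_mod_cast hz2
  have e1 : δ * (s * ⌊x / (s * δ)⌋) ≤ δ * zk := mul_le_mul_of_nonneg_left hz1' hδ.le
  have e2 : δ * zk ≤ δ * (s * ⌊x / (s * δ)⌋ + s) := mul_le_mul_of_nonneg_left hz2' hδ.le
  rw [abs_le]; constructor <;> nlinarith

/-- **The first square sits at the first centre**: its sites are within `2 s δ` of `c 0` in each coordinate.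
[folklore] -/
theorem gridCorner_first_near (hδ : 0 < δ) (hsδ : 0 < (s : ℝ) * δ) (hKP : 0 < K * P) (z : Site 2)
    (h1 : gridCorner c K δ s P 0 0 ≤ z 0) (h2 : z 0 ≤ gridCorner c K δ s P 0 0 + s)
    (h3 : gridCorner c K δ s P 0 1 ≤ z 1) (h4 : z 1 ≤ gridCorner c K δ s P 0 1 + s) :
    |δ * z 0 - (c 0).re| ≤ 2 * s * δ ∧ |δ * z 1 - (c 0).im| ≤ 2 * s * δ := by
  have hcell : gridCell c K δ s P 0 = anchorCell δ s (c 0) := by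
    unfold gridCell; rw [if_pos hKP, Nat.zero_div, Nat.zero_mod, manhattan_zero]
  simp only [gridCorner_apply, hcell] at h1 h2 h3 h4
  exact ⟨abs_sub_le_of_anchor hδ hsδ _ _ h1 h2, abs_sub_le_of_anchor hδ hsδ _ _ h3 h4⟩

/-- **The last square sits at the last centre**: its sites are within `2 s δ` of `c K` in each coordinate.
[folklore] -/
theorem gridCorner_last_near (hδ : 0 < δ) (hsδ : 0 < (s : ℝ) * δ) (z : Site 2)
    (h1 : gridCorner c K δ s P (K * P) 0 ≤ z 0) (h2 : z 0 ≤ gridCorner c K δ s P (K * P) 0 + s)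
    (h3 : gridCorner c K δ s P (K * P) 1 ≤ z 1) (h4 : z 1 ≤ gridCorner c K δ s P (K * P) 1 + s) :
    |δ * z 0 - (c K).re| ≤ 2 * s * δ ∧ |δ * z 1 - (c K).im| ≤ 2 * s * δ := by
  have hcell : gridCell c K δ s P (K * P) = anchorCell δ s (c K) := by
    unfold gridCell; rw [if_neg (lt_irrefl _)]
  simp only [gridCorner_apply, hcell] at h1 h2 h3 h4
  exact ⟨abs_sub_le_of_anchor hδ hsδ _ _ h1 h2, abs_sub_le_of_anchor hδ hsδ _ _ h3 h4⟩

end Grid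

end RadialChain

/-- **Consecutive squares of the grid path are equal or side-adjacent** (registered sub-goal of
stmt-CriticalPhenomena-10650, clause (iii) helper; closed form of `RadialChain.gridCorner_step`). [folklore] -/
theorem radial_gridCorner_step : ∀ {c : ℕ → ℂ} {K : ℕ} {δ : ℝ} {s P : ℕ}, 0 < (s : ℝ) * δ → (∀ j < K, 2 * (‖c (j + 1) - c j‖ / (s * δ) + 1) ≤ (P : ℝ) - 1) → ∀ (i : ℕ), i < K * P → RadialChain.gridCorner c K δ s P (i + 1) = RadialChain.gridCorner c K δ s P i ∨ RadialChain.gridCorner c K δ s P (i + 1) = RadialChain.gridCorner c K δ s P i + ![(s : ℤ), 0] ∨ RadialChain.gridCorner c K δ s P i = RadialChain.gridCorner c K δ s P (i + 1) + ![(s : ℤ), 0] ∨ RadialChain.gridCorner c K δ s P (i + 1) = RadialChain.gridCorner c K δ s P i + ![(0 : ℤ), s] ∨ RadialChain.gridCorner c K δ s P i = RadialChain.gridCorner c K δ s P (i + 1) + ![(0 : ℤ), s] :=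
  fun hsδ hP i hi => RadialChain.gridCorner_step hsδ hP i hi

end Summit.CriticalPhenomena.SAWScalingLimit.Theorems.IsingBoundaryRatio

end
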